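import Summits.QuantumFields.YangMills.Theorems.AlphaInputsT3ACv3DataSchemaR
import Summits.QuantumFields.YangMills.Theorems.AlphaInputsT3ACv3LaneChi
import HarnessLib

/-!
# `AlphaInputsT3ACv3DataSchemaChi` — THE DISPLAYED DATA SCHEMA OF 2′χ (R-57χ NAME-MAP port «DataSchema ∕ MinimiserPin* knit ↦ …Chi», owner RULING g23-№2
# ADDENDA 2∕5∕6, R57chi README «TO COME»): the DISPLAYED step data WITH PRINT'S LOWER ROW, the data rows and the data schema over the READ-LOCAL class `𝒞_R`
# — lane `pub-balaban3d`, seat alpha-1 (g12)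

WHY (cell `ym3-torus`, route `UnitScaleTilt`, crux 2′ → 2′χ on stmt-QuantumFields-19936 ∕ -19935 ∕ -20520).  The displayed (β) residual R3D-02 `fibre57Low :
Bound55AC.Fibre57LowAC …` of `AlphaV3AC.StepDataV3AC` (the lower step bound with the tower's (4) FIELD window on the left AND inside the fibre integral) is false for
Bałaban's objects at block sizes `L ∈ {3,5}` (cell finding #44 ∕ F-r1-g2-1); the owner's repair R-57χ (ADDENDUM 5: H1ᴰ, N-1) replaces it by print's own row —
`fibre57LowOn : PinnedStep.Fibre57LowOnAC … (PinnedStep.loPrintAC …) k`, print's χ (the MINIMISER window of (47) p.267 inside the (4)-window) on both sides — ADDITIVELY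
(ADDENDUM 2: new names, old files byte-unchanged).  The χ-record `AlphaV3AC.StepAlphaV3ChiAC ∕ RunAlphaV3ChiAC` is `AlphaInputsT3ACv3LaneChi`'s; this file and its two
siblings port the DISPLAY of 2′ (alpha-2's `…v3DataSchemaR` ∕ `…v3CoreNonemptyR` over the read-local class `𝒞_R`, the variant of record after alpha-2's located
refutation-as-typed of (D6L), HOME `D6L-STATUS-alpha2-g3.md` §3) to that record, with the minimum of new text: the 22 row-stable data rows ONCE as `StepDataV3CoreAC`
(both the old data `StepDataV3AC.toCore` and the χ-data `StepDataV3ChiAC extends` it project to it — owner ADDENDUM 6 §3 «data core»), so the (55)-row `fibre55Win` is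
`PinnedStep.Fibre55WinAC` BY NAME and R-g18-a∕B2 is inherited.  SIBLINGS: `AlphaInputsT3ACMinimiserPinKnitRecChi` (the knit to the schema from [7] Thm 1 + sizes +
(D6R-CHARGED), 2′χ's record-parametric display `AlphaInputsT3AC.PinnedPartsT3ACRecRChi L`, its constants shell), `AlphaInputsT3ACv3OfDataSchemaChi` (the assembly to the
socket `OfV3ChiAt` ∕ `AlphaInputsT3ACv3RecChi` of `AlphaInputsT3ACv3Chi`).

CONTENTS (`structure … : Prop` ∕ `def … : Prop` below are HYPOTHESIS SCHEMAS, OPEN, never asserted; everything else is proved):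
* §1 `AlphaV3AC.StepDataV3CoreAC k` (= `StepDataV3AC` minus `fibre57Low` = `StepAlphaV3CoreAC` minus the class-I row `hU`; field names∕texts∕locators VERBATIM),
  `AlphaV3AC.StepDataV3ChiAC k` (extends it by `fibre57LowOn`; NAME MAP `StepDataV3AC ↦ StepDataV3ChiAC`, `fibre57Low ↦ fibre57LowOn`, every other field name unchanged),
  projections `StepDataV3AC.toCore`, `StepDataV3CoreAC.toStepAlphaCore` (+ `hU` = the core step package), `StepDataV3ChiAC.toStepAlphaChi` (+ `hU` = the χ step package).
* §2 the displayed rows over `𝒞_R` in χ-currency: `AlphaInputsT3AC.DataRowsT3RChi` (= `DataRowsT3R` with `StepDataV3AC ↦ StepDataV3ChiAC`), `DataSchemaT3ACRChi`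
  (= `DataSchemaT3ACR` with `DataRowsT3R ↦ DataRowsT3RChi`); (N1) `WindowIneqT3`, (D6R) `AdaptedClassNonemptyT3R`, (D5) `TrivMinimiserRowsT3`, `AdaptedToT3R` are REUSED by name.
HONEST FRAMING.  Bookkeeping of displayed HYPOTHESIS rows of a conditional route against print; nothing of the cluster expansion ([Balaban1985UV3] §§2–3) or of
[Balaban1985Variational] Thm 1 is proved or asserted; the data rows are displayed FOR the constructed (read-local argmin) minimisers (lane B's honesty line, unchanged).
Count-neutral helper toward 2′χ; registry untouched; not a claim about d = 4, the continuum, or a mass gap.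

References: T. Bałaban, Commun. Math. Phys. 102 (1985) 255–275 [Balaban1985UV3] ((23)–(33) pp.262–264, (40)–(44) pp.266–267, (47) p.267, (49)–(63) pp.268–272,
(67)–(68) p.273, Thm 2 p.272, p.272 L32–33); Commun. Math. Phys. 102 (1985) 277–309 [Balaban1985Variational] (Thm 1 (8) p.279).
-/

set_option autoImplicit false

noncomputable section


namespace Summit.QuantumFields.YangMills.Theorems.AlphaV3AC

open MeasureTheory Metric
open scoped BigOperators Matrix.Norms.L2Operator
open Literature.MathematicalPhysics.QuantumFieldTheory.Balaban1983to89
open Literature.MathematicalPhysics.QuantumFieldTheory.Balaban1983to89.B10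
open Literature.MathematicalPhysics.QuantumFieldTheory.Balaban1983to89.B10SectAGathering
open Literature.MathematicalPhysics.QuantumFieldTheory.Balaban1983to89.B10SectCExpansion (Bound44)
open Literature.MathematicalPhysics.QuantumFieldTheory.Balaban1983to89.B10Eq24Cumulant (chiMeasure)
open Literature.MathematicalPhysics.QuantumFieldTheory.Balaban1983to89.TreeLengthTorus (tsys)
open Literature.MathematicalPhysics.QuantumFieldTheory.Balaban1985CMP102
open Literature.MathematicalPhysics.QuantumFieldTheory.Balaban1985CMP102.Setting
open Literature.MathematicalPhysics.QuantumFieldTheory.Balaban1985CMP102.Binders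
  (ChartAnalyticityAsCited FarTermsDecayAsCited Norm35StepAsCited LogZTExtensiveAsCited GraphRep23AsCited)
open Summit.QuantumFields.Balaban3D.Carriers
open Summit.QuantumFields.Balaban3D.Proofs.Inputs
open Summit.QuantumFields.Balaban3D.Proofs.Primitives
open Summit.QuantumFields.Balaban3D.Proofs.UVStability3DInputs (adjAct hdet_adjAct)
open Summit.QuantumFields.Balaban3D.Proofs.Representation33 (jet26)
open Summit.QuantumFields.Balaban3D.Proofs.LiftBridge (liftCfg)
open Summit.QuantumFields.Balaban3D.Proofs.Run3SmallFactors (codeZ)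
open Summit.QuantumFields.Balaban3D.Proofs.GroupModelLieC (lieC)
open Summit.QuantumFields.Balaban3D.Proofs.TowerAC
open Summit.QuantumFields.Balaban3D.Proofs.SeriesAC
open Summit.QuantumFields.Balaban3D.Proofs.StandardAC
open Summit.QuantumFields.Balaban3D.Proofs.InputsAC
open Summit.QuantumFields.Balaban3D.Proofs.Bound55AC
open Summit.QuantumFields.Balaban3D.Proofs.AlphaAC
open Summit.QuantumFields.Balaban3D.Proofs.AlphaAdaptersAC
open B7Prop1Explicit (hol plaqWord)
open B7Prop1Local (pdevOn loK plaqHiK)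
open B7Prop2Explicit (avgIter)

variable {L : ℕ}

/-! ## §1 The DISPLAYED step data with print's lower row: the row-stable data core, and the χ-data extending it -/

section Data

variable {S : Scales L} {G : Type} [GaugeGroup G] [MeasurableSpace G] [HaarData G] (𝔊 : GroupModel G) (𝔠 : AlphaConsts L 𝔊.N)
  (X : ExternalInputsAC S G) (𝔖 : ∀ k, StepSeries S G ↥(lieC 𝔊) (nblkOf S 𝔠.lane.carrier k) k) (𝔄 : AlphaDataAC 𝔊 𝔠 X 𝔖)
  (win : (k : ℕ) → Hist S.P (k + 1) → Set (GaugeField S.P (k + 1) G))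

open Classical in
/-- **THE ROW-STABLE DATA CORE OF THE DISPLAYED (α) STEP DATA `k → k+1`**: the 22 rows of `AlphaV3AC.StepDataV3AC k` that do NOT read the lower residual — VERBATIM (same
field names, same texts, same locators) = `AlphaV3AC.StepAlphaV3CoreAC k` minus its class-I row `hU` (measurability of `U_k(·, h)`, supplied by strategy B's construction).
Both the old displayed data (`StepDataV3AC.toCore`) and the χ-data (`StepDataV3ChiAC extends` it) project to it; the (55)-row `fibre55Win` is `PinnedStep.Fibre55WinAC` by
name (R-g18-a∕B2 inherited).  HYPOTHESES; nothing asserted. [cite: Balaban1985UV3, (23)–(33) pp.262–264 + (44) p.267 + (49)–(63) pp.268–272] -/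
structure StepDataV3CoreAC (k : ℕ) : Prop where
  /-- the Gaussian measure of (58) is a probability measure -/
  hμ : IsProbabilityMeasure (𝔖 k).μ
  /-- the small-field box is measurable -/
  hboxm : ∀ h, MeasurableSet ((𝔖 k).box h)
  /-- … of positive measure -/
  hbox : ∀ h, (𝔖 k).μ ((𝔖 k).box h) ≠ 0
  /-- the effective potential is a.e.-measurable -/
  hVm : ∀ h U, AEMeasurable ((𝔖 k).𝒱 h U) (𝔖 k).μ
  /-- … and bounded on the box -/
  hVB : ∀ h U, ∀ ω ∈ (𝔖 k).box h, |(𝔖 k).𝒱 h U ω| ≤ 𝔄.Bv k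
  /-- G3D-01 at the (25)-rate (R-ACT) -/
  chart : ∀ Y, ChartAnalyticityAsCited ((𝔖 k).Ψ Y) 𝔠.ρ
    (𝔠.C25 * S.gk k * Real.exp (-(𝔠.κ * (tsys 3 (nblkOf S 𝔠.lane.carrier k)).dj Y)))
  /-- (28) p. 263 -/
  bound28 : ∀ Y h U, ‖(𝔖 k).Bcfg Y h U‖ ≤ 𝔠.cB * (rFun 𝔠.r₀ (S.gk k) * S.gk k * pFun 𝔠.b₀ 𝔠.p₀ (S.gk k))
  /-- (26) in the chart space, for the adjoint action -/
  inv26 : ∀ Y (U : G), ∀ b ∈ ball (0 : (𝔖 k).E) 𝔠.ρ, adjAct 𝔊 (P := S.P) k U b ∈ ball (0 : (𝔖 k).E) 𝔠.ρ →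
    (𝔖 k).Ψ Y (adjAct 𝔊 (P := S.P) k U b) = (𝔖 k).Ψ Y b
  /-- G3D-06 -/
  far_le : FarTermsDecayAsCited (𝔖 k).far
    (fun Y => 𝔠.C25 * S.gk k * Real.exp (-(𝔠.κ * (tsys 3 (nblkOf S 𝔠.lane.carrier k)).dj Y)))
    𝔠.Cfar (S.gk k ^ 7 * (rFun 𝔠.r₀ (S.gk k) * pFun 𝔠.b₀ 𝔠.p₀ (S.gk k)) ^ 7)
  /-- identification of `PY` with the retained jet (batch 11 (a)) -/
  hPY : ∀ h U, (𝔖 k).PY h U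
    = ∑ Y ∈ (𝔖 k).loc (ΩblkOf 𝔠.lane.carrier.M₁ (rcolOf S 𝔠.lane.carrier) (nblkOf S 𝔠.lane.carrier k)) (rretOf S 𝔠.lane.carrier k) h,
        ((jet26 ((𝔖 k).Ψ Y) ((𝔖 k).Bcfg Y h U)).re - (𝔖 k).far Y h U)
  /-- identification of `PYZ` with the retained jet of the G3D-07 pieces -/
  hPYZ : ∀ h U, (𝔖 k).PYZ h U
    = ∑ Y ∈ (𝔖 k).loc (ΩblkOf 𝔠.lane.carrier.M₁ (rcolOf S 𝔠.lane.carrier) (nblkOf S 𝔠.lane.carrier k)) (rretOf S 𝔠.lane.carrier k) h,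
        ((jet26 ((𝔄.Λc k).Ψ Y) ((𝔖 k).Bcfg Y h U)).re - (𝔄.Λc k).far Y h U)
  /-- G3D-04 -/
  norm35 : Norm35StepAsCited (piecesAC 𝔠.lane X 𝔖 k) 𝔠.c35 𝔠.a35 𝔠.cv 𝔠.cJ35
  /-- G3D-05 -/
  logZT : LogZTExtensiveAsCited (piecesAC 𝔠.lane X 𝔖 k) 𝔠.cT 𝔠.aT 𝔠.cn 𝔠.cJT
  /-- R-ACT: the graph carrier's activities are the chart activities -/
  hact : ∀ h Y U, ((𝔖 k).Gt h).activities.act Y U = (𝔖 k).act h Y U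
  /-- G3D-02 -/
  hG : ∀ h, GraphRep23AsCited ((𝔖 k).Gt h) (fun U => ∑ n ∈ Finset.Icc 1 𝔠.nbar, (𝔖 k).cum h U n / (n.factorial : ℝ))
    (𝔄.C₂₃ k) (𝔄.c₂₃ k) (𝔄.M₂₃ k) (𝔄.δ₀ k)
  /-- [B1] (3.24) input (a), in the unit `(L^kg₀²)^{3+κ₀}|T₁^{(k)}|` -/
  h324a : ∀ h (U : GaugeField S.P (k + 1) G), |Real.log ((𝔖 k).μ.real ((𝔖 k).box h))| ≤
    𝔠.Ca * ((L : ℝ) ^ k * S.g0sq) ^ (3 + 𝔠.κ₀) * S.sites k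
  /-- [B1] (3.24) input (c) -/
  h324c : ∀ h U, ∀ t ∈ Set.Icc (0 : ℝ) 1, |iteratedDeriv (𝔠.nbar + 1) (ProbabilityTheory.cgf ((𝔖 k).𝒱 h U)
    (chiMeasure (𝔖 k).μ (((𝔖 k).box h).indicator fun _ => (1 : ℝ)))) t| ≤
      𝔠.Cc * ((𝔠.nbar + 1).factorial : ℝ) * ((L : ℝ) ^ k * S.g0sq) ^ (3 + 𝔠.κ₀) * S.sites k
  /-- (44) p. 267 on the previous-scale terms of the data (ONE row: consumers B15 and C10) -/
  h44 : ∀ (h : Hist S.P (k + 1)) (U : GaugeField S.P (k + 1) G), ∀ j ∈ Finset.Icc 1 k,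
    Bound44 (oldGeom S.P k j) (fun y n c => (𝔖 k).oldVal h U j y n c) 𝔠.κ₁ (𝔠.M₁ : ℝ) (ell S.P k j) (L : ℝ) 𝔠.B₃
      (S.gk k) (pFun 𝔠.b₀ 𝔠.p₀ (S.gk k)) 𝔠.C44
  /-- the degree floor «n ≥ 2» of (43) for the previous-scale terms -/
  hfloor : ∀ (h : Hist S.P (k + 1)) (U : GaugeField S.P (k + 1) G), ∀ j ∈ Finset.Icc 1 k,
    ∀ (y : Site S.P j) (n : ℕ) (c : Fin n → PBond S.P j), (𝔖 k).oldVal h U j y n c ≠ 0 → 2 ≤ n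
  /-- data regularity: the interaction sum `Pint k h` of (43) (DEFINED from the activities) is measurable in `U` … -/
  hPm : ∀ h : Hist S.P k, Measurable ((inputOfAC 𝔠.lane X 𝔖).Pint k h)
  /-- … and bounded above -/
  hPb : ∀ (h : Hist S.P k) (U : GaugeField S.P k G), (inputOfAC 𝔠.lane X 𝔖).Pint k h U ≤ 𝔄.cP k
  /-- RESIDUAL R3D-01 (v3): (55) p.269 with (58) p.270 per new history, PINNED masses, print's `χ_{k+1}` window on the right (`PinnedStep.Fibre55WinAC`) -/
  fibre55Win : ∀ h' : Hist S.P (k + 1), PinnedStep.Fibre55WinAC 𝔠.lane X 𝔖 win k h'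

open Classical in
/-- **THE DISPLAYED (α) STEP DATA OF STEP `k → k+1` WITH PRINT'S LOWER ROW** (the χ-data; NAME MAP `StepDataV3AC ↦ StepDataV3ChiAC`): the data core and, in place of the
retired R3D-02 `fibre57Low : Bound55AC.Fibre57LowAC …` (tower's (4) field window on both sides), the row `fibre57LowOn`: [Balaban1985UV3] p.272 L32–33 ∕ (37) p.265 with
PRINT'S χ — the validity family `PinnedStep.loPrintAC` («χ_k corresponds to the restrictions on V given by the conditions |U_k(∂p) − 1| < g_kp(g_k)η²», (47) p.267, on the
input's own minimiser, inside the (4)-window) — on the LEFT at level `k+1` and INSIDE the fibre integral at level `k` (`PinnedStep.Fibre57LowOnAC`) = the field of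
`AlphaV3AC.StepAlphaV3ChiAC` by name.  `StepDataV3ChiAC` + `hU` = `StepAlphaV3ChiAC` (`toStepAlphaChi`).  HYPOTHESES; nothing asserted.
[cite: Balaban1985UV3, p.265 L21–28 + (47) p.267 + p.272 L32–33] -/
structure StepDataV3ChiAC (k : ℕ) : Prop extends StepDataV3CoreAC 𝔊 𝔠 X 𝔖 𝔄 win k where
  /-- RESIDUAL R3D-02χ: print's lower step bound at the trivial history, print's χ (minimiser window inside the (4)-window) on both sides -/
  fibre57LowOn : PinnedStep.Fibre57LowOnAC 𝔠.lane X 𝔖 (PinnedStep.loPrintAC 𝔠.lane X) k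

variable {𝔊 𝔠 X 𝔖 𝔄 win}

/-- The old displayed step data project to the data core (field by field; `fibre57Low` dropped). [folklore] -/
theorem StepDataV3AC.toCore {k : ℕ} (D : StepDataV3AC 𝔊 𝔠 X 𝔖 𝔄 win k) : StepDataV3CoreAC 𝔊 𝔠 X 𝔖 𝔄 win k where
  hμ := D.hμ
  hboxm := D.hboxm
  hbox := D.hbox
  hVm := D.hVm
  hVB := D.hVB
  chart := D.chart
  bound28 := D.bound28
  inv26 := D.inv26
  far_le := D.far_le
  hPY := D.hPY
  hPYZ := D.hPYZ
  norm35 := D.norm35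
  logZT := D.logZT
  hact := D.hact
  hG := D.hG
  h324a := D.h324a
  h324c := D.h324c
  h44 := D.h44
  hfloor := D.hfloor
  hPm := D.hPm
  hPb := D.hPb
  fibre55Win := D.fibre55Win

/-- **DATA CORE + `hU` = THE CORE STEP PACKAGE**: the displayed core data rows together with the measurability of `U_k(·, h)` give `StepAlphaV3CoreAC k` (field by field).
[cite: Balaban1985UV3, (41) p.266 (bookkeeping)] -/
theorem StepDataV3CoreAC.toStepAlphaCore {k : ℕ} (D : StepDataV3CoreAC 𝔊 𝔠 X 𝔖 𝔄 win k) (hU : ∀ h : Hist S.P k, Measurable (X.UkH k h)) :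
    StepAlphaV3CoreAC 𝔊 𝔠 X 𝔖 𝔄 win k where
  hμ := D.hμ
  hboxm := D.hboxm
  hbox := D.hbox
  hVm := D.hVm
  hVB := D.hVB
  chart := D.chart
  bound28 := D.bound28
  inv26 := D.inv26
  far_le := D.far_le
  hPY := D.hPY
  hPYZ := D.hPYZ
  norm35 := D.norm35
  logZT := D.logZT
  hact := D.hact
  hG := D.hG
  h324a := D.h324a
  h324c := D.h324c
  h44 := D.h44
  hfloor := D.hfloor
  hU := hU
  hPm := D.hPm
  hPb := D.hPb
  fibre55Win := D.fibre55Win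

/-- **χ-DATA + `hU` = THE χ STEP PACKAGE**: the displayed χ-data rows together with the measurability of `U_k(·, h)` give `StepAlphaV3ChiAC k` (the core through
`toStepAlphaCore`, `fibre57LowOn` passed through). [cite: Balaban1985UV3, (41) p.266 + (47) p.267 (bookkeeping)] -/
theorem StepDataV3ChiAC.toStepAlphaChi {k : ℕ} (D : StepDataV3ChiAC 𝔊 𝔠 X 𝔖 𝔄 win k) (hU : ∀ h : Hist S.P k, Measurable (X.UkH k h)) :
    StepAlphaV3ChiAC 𝔊 𝔠 X 𝔖 𝔄 win k where
  toStepAlphaV3CoreAC := D.toStepDataV3CoreAC.toStepAlphaCore hU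
  fibre57LowOn := D.fibre57LowOn

end Data

end Summit.QuantumFields.YangMills.Theorems.AlphaV3AC

namespace Summit.QuantumFields.YangMills.Theorems

open MeasureTheory Set
open scoped Matrix Matrix.Norms.L2Operator
open Literature.MathematicalPhysics.QuantumFieldTheory.Balaban1983to89
open Literature.MathematicalPhysics.QuantumFieldTheory.Balaban1983to89.T3ContinuumYM3Torus
open Literature.MathematicalPhysics.QuantumFieldTheory.Balaban1983to89.T3UnitScaleTilt (θBal)
open Literature.MathematicalPhysics.QuantumFieldTheory.Balaban1985CMP102
open Literature.MathematicalPhysics.QuantumFieldTheory.Balaban1985CMP102.Setting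
open Summit.QuantumFields.Balaban3D.Carriers
open Summit.QuantumFields.Balaban3D.Proofs.Primitives
open Summit.QuantumFields.Balaban3D.Proofs.GroupModelLieC (lieC)
open Summit.QuantumFields.Balaban3D.Proofs.TowerAC
open Summit.QuantumFields.Balaban3D.Proofs.StandardAC
open Summit.QuantumFields.Balaban3D.Proofs.InputsAC
open Summit.QuantumFields.Balaban3D.Proofs.AlphaAC (AlphaDataAC)
open Summit.QuantumFields.YangMills.Theorems.AlphaV3AC

/-! ## §2 The displayed data rows and the data schema over the read-local class, in χ-currency -/

section Schema

variable (F : T3Family) (𝔠 : AlphaConsts F.L (suGroupModel 2).N) (γ : ℝ) (hγ : 0 < γ) (hγ1 : γ ≤ (min 𝔠.gamma0 1) ^ 2)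

/-- **(D1)–(D4), (D7) THE DISPLAYED CLUSTER-EXPANSION DATA ROWS OVER THE READ-LOCAL CLASS, WITH PRINT'S LOWER ROW** (hypothesis schema, never asserted; NAME MAP
`DataRowsT3R ↦ DataRowsT3RChi`): alpha-2's `AlphaInputsT3AC.DataRowsT3R` VERBATIM with `StepDataV3AC ↦ StepDataV3ChiAC` — for EVERY read-local adapted minimiser data
(`AdaptedToT3R … Ut UkH`, `U_k := U_{k+1}(·, triv)`, regular classes `univ`, `U_0(·, triv) = id`) there are expansion data `𝔖` and auxiliary data `𝔄` for the pinned AC inputs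
`XT3` such that the displayed χ step data `AlphaV3AC.StepDataV3ChiAC` hold at every step `k < K` for the (40) windows `admWindowT3`, and the terminal `Pint_K` rows hold.
[cite: Balaban1985UV3, Thm 2 p.272 + (41) p.266 + (47) p.267 + (55) p.269] -/
def AlphaInputsT3AC.DataRowsT3RChi (K : ℕ)
    (Ut : (k : ℕ) → GaugeField (F.P K) k (Matrix.specialUnitaryGroup (Fin 2) ℂ) → GaugeField (F.P K) 0 (Matrix.specialUnitaryGroup (Fin 2) ℂ)) : Prop :=
  ∀ (UkH : (k : ℕ) → Hist (F.P K) k → GaugeField (F.P K) k (Matrix.specialUnitaryGroup (Fin 2) ℂ) →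
      GaugeField (F.P K) 0 (Matrix.specialUnitaryGroup (Fin 2) ℂ))
    (hU0 : ∀ V : GaugeField (F.P K) 0 (Matrix.specialUnitaryGroup (Fin 2) ℂ), UkH 0 (Hist.triv (F.P K) 0) V = V),
    AlphaInputsT3AC.AdaptedToT3R F 𝔠 γ hγ hγ1 K Ut UkH →
    ∃ (𝔖 : ∀ k, StepSeries (T3Scales F γ hγ (hγ1.trans (sq_min_one_le _ 𝔠.gamma0_pos)) K)
        (Matrix.specialUnitaryGroup (Fin 2) ℂ) ↥(lieC (suGroupModel 2))
        (nblkOf (T3Scales F γ hγ (hγ1.trans (sq_min_one_le _ 𝔠.gamma0_pos)) K) 𝔠.lane.carrier k) k)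
      (𝔄 : AlphaDataAC (suGroupModel 2) 𝔠
        (XT3 F γ hγ (hγ1.trans (sq_min_one_le _ 𝔠.gamma0_pos)) K (fun _ => Set.univ)
          (fun k => UkH (k + 1) (Hist.triv (F.P K) (k + 1))) UkH hU0 (fun _ _ => rfl)) 𝔖),
      (∀ k, k + 1 ≤ K → StepDataV3ChiAC (suGroupModel 2) 𝔠
        (XT3 F γ hγ (hγ1.trans (sq_min_one_le _ 𝔠.gamma0_pos)) K (fun _ => Set.univ)
          (fun k => UkH (k + 1) (Hist.triv (F.P K) (k + 1))) UkH hU0 (fun _ _ => rfl)) 𝔖 𝔄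
        (AlphaInputsT3AC.admWindowT3 F 𝔠 γ hγ hγ1 K) k) ∧
      (∀ h : Hist (F.P K) K, Measurable ((inputOfAC 𝔠.lane
        (XT3 F γ hγ (hγ1.trans (sq_min_one_le _ 𝔠.gamma0_pos)) K (fun _ => Set.univ)
          (fun k => UkH (k + 1) (Hist.triv (F.P K) (k + 1))) UkH hU0 (fun _ _ => rfl)) 𝔖).Pint K h)) ∧
      (∀ (h : Hist (F.P K) K) (U : GaugeField (F.P K) K (Matrix.specialUnitaryGroup (Fin 2) ℂ)), (inputOfAC 𝔠.lane
        (XT3 F γ hγ (hγ1.trans (sq_min_one_le _ 𝔠.gamma0_pos)) K (fun _ => Set.univ)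
          (fun k => UkH (k + 1) (Hist.triv (F.P K) (k + 1))) UkH hU0 (fun _ _ => rfl)) 𝔖).Pint K h U ≤ 𝔄.cP K)

end Schema

/-- **`DataSchemaT3ACRChi F 𝔠 a₀ a₁` — THE DISPLAYED DATA SCHEMA OF STRATEGY B OVER THE READ-LOCAL CLASS, WITH PRINT'S LOWER ROW** (hypothesis schema, OPEN, never
asserted; NAME MAP `DataSchemaT3ACR ↦ DataSchemaT3ACRChi`): for every coupling `γ ∈ (0, (min γ₀ 1)²]` and run `K`: (N1) the window inequality; (D6R) non-emptiness of the
read-local adapted classes; and a trivial-history minimiser family `Ut` with (D5) [7] Thm 1's rows for which the χ data rows hold for every read-local adapted minimiser data.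
With it the sibling `ofV3ChiAt_of_dataSchemaT3RChi` CONSTRUCTS `OfV3ChiAt F 𝔠 a₀ a₁`.
[cite: Balaban1985UV3, Thm 2 p.272 + (40)–(42) p.266 + (47) p.267 + (55) p.269 + (67)–(68) p.273; Balaban1985Variational, Thm 1 (8) p.279] -/
def DataSchemaT3ACRChi (F : T3Family) (𝔠 : AlphaConsts F.L (suGroupModel 2).N) (a₀ a₁ : ℝ) : Prop :=
  ∀ (γ : ℝ) (hγ : 0 < γ) (hγ1 : γ ≤ (min 𝔠.gamma0 1) ^ 2) (K : ℕ),
    AlphaInputsT3AC.WindowIneqT3 F 𝔠 γ K ∧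
    AlphaInputsT3AC.AdaptedClassNonemptyT3R F 𝔠 γ hγ hγ1 K ∧
    ∃ Ut : (k : ℕ) → GaugeField (F.P K) k (Matrix.specialUnitaryGroup (Fin 2) ℂ) → GaugeField (F.P K) 0 (Matrix.specialUnitaryGroup (Fin 2) ℂ),
      AlphaInputsT3AC.TrivMinimiserRowsT3 F 𝔠 γ hγ hγ1 a₀ a₁ K Ut ∧ AlphaInputsT3AC.DataRowsT3RChi F 𝔠 γ hγ hγ1 K Ut

end Summit.QuantumFields.YangMills.Theorems

end
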